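import Mathlib
import Literature.Analysis.Complex.CauchyPompeiu
import Literature.Analysis.Complex.CauchyTransform
import Literature.Analysis.Complex.CauchyTransformBounds
import Literature.Analysis.Complex.WeylLemmaDbar
import Literature.Analysis.Complex.DbarBumpResidue

/-!
# Approximate holomorphy from a small `∂̄` (Cauchy–Pompeiu with a cut-off)

If `k : ℂ → ℂ` is smooth with `‖∂̄k‖ ≤ ε` on the closed disc `‖η‖ ≤ ρ` (`∂̄ = ½(∂ₓ + i∂_y)`, the
tree's `Literature.Analysis.Complex.dbarAlong 1`), then on every smaller closed disc
`‖η‖ ≤ ρ' < ρ` it is uniformly `C ε`-close to a function holomorphic on `B(0, ρ')`, with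
`C = 4ρ` depending only on the radii.

Proof: take a smooth cut-off `χ` with `χ = 1` on `B̄(0, ρₘ)`, `ρₘ = (ρ' + ρ)/2`, supported in
`B(0, ρ)`, `0 ≤ χ ≤ 1`. Cauchy–Pompeiu for `χk ∈ C¹_c` and the Leibniz rule give
`χk = T(∂̄(χk)) = T(∂̄χ · k) + T(χ ∂̄k)` with `T` the Cauchy transform. The density `∂̄χ · k`
vanishes on `B(0, ρₘ)`, so `H = T(∂̄χ · k)` is holomorphic on `B(0, ρ')`; the density `χ ∂̄k` is
bounded by `ε` and supported in `B(0, ρ)`, so `‖T(χ ∂̄k)(η)‖ ≤ 2 · 2ρ · ε` for `‖η‖ ≤ ρ'`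
(sup bound for the Cauchy transform). On `‖η‖ ≤ ρ'` we have `χ = 1`, whence
`‖k η - H η‖ ≤ 4ρ ε`.
-/

set_option linter.dupNamespace false

noncomputable section

open scoped ContDiff Topology Real
open Set Metric MeasureTheory Filter Literature.Analysis.Complex

namespace Summit.SmoothPoincare4.SmoothPoincare4.Cruxes.TameOrBrodyR4.Sketch

namespace ApproxHolomorphic

/-- Change of variables `t = w - z` in the one-variable Cauchy transform:
`(T F)(w) = ∫ (π t)⁻¹ F(w - t) dA(t) = -∫ F(z) (π (z - w))⁻¹ dA(z)`. -/
theorem cauchyTransform_eq_neg_integral (F : ℂ → ℂ) (w : ℂ) :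
    cauchyTransformAlong 1 F w = -∫ z, F z * (↑π * (z - w))⁻¹ := by
  have h1 : cauchyTransformAlong 1 F w = ∫ z, (↑π * (w - z))⁻¹ * F z := by
    rw [cauchyTransformAlong_one_apply]
    have h := integral_sub_left_eq_self (fun z : ℂ => (↑π * (w - z))⁻¹ * F z) volume w
    simp only [sub_sub_cancel, smul_eq_mul] at h ⊢
    exact h
  rw [h1, ← integral_neg]
  congr 1
  funext z
  rw [← neg_sub z w, mul_neg, inv_neg]
  ring

/-- **Holomorphy of the Cauchy transform off the support of the density.** If `a` is continuous
with compact support and vanishes on `B(0, ρₘ)`, then `T a` is holomorphic on `B(0, ρ')` for every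
`ρ' < ρₘ`. -/
theorem differentiableOn_cauchyTransform_of_eq_zero {a : ℂ → ℂ} (ha : Continuous a)
    (hac : HasCompactSupport a) {ρ' ρm : ℝ} (h : ρ' < ρm)
    (hzero : ∀ z ∈ ball (0 : ℂ) ρm, a z = 0) :
    DifferentiableOn ℂ (cauchyTransformAlong 1 a) (ball 0 ρ') := by
  have hint : Integrable a := ha.integrable_of_hasCompactSupport hac
  have key := (differentiableOn_integral_mul_cauchyKernel hint h hzero).neg
  have e : cauchyTransformAlong 1 a = fun w => -∫ z, a z * (↑π * (z - w))⁻¹ :=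
    funext (cauchyTransform_eq_neg_integral a)
  rw [e]
  exact key

/-- **Sup bound.** If `‖e‖ ≤ ε` everywhere and `e` vanishes off `B(0, ρ)`, then
`‖(T e)(w)‖ ≤ 2 · 2ρ · ε` for `‖w‖ ≤ ρ` (the density `t ↦ e (w - t)` lives in `‖t‖ < 2ρ`). -/
theorem norm_cauchyTransform_le_of_forall_le {e : ℂ → ℂ} {ρ ε : ℝ} (hρ : 0 ≤ ρ) (hε : 0 ≤ ε)
    (hsupp : ∀ z, e z ≠ 0 → ‖z‖ < ρ) (hbound : ∀ z, ‖e z‖ ≤ ε) {w : ℂ} (hw : ‖w‖ ≤ ρ) :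
    ‖cauchyTransformAlong 1 e w‖ ≤ 2 * (2 * ρ) * ε := by
  refine norm_cauchyTransformAlong_le (by linarith) hε (fun t ht => ?_) (fun t => ?_)
  · rw [smul_eq_mul, mul_one] at ht
    have h1 := hsupp _ ht
    have h2 : ‖t‖ ≤ ‖w‖ + ‖w - t‖ := by
      have := norm_sub_le w (w - t)
      rwa [sub_sub_cancel] at this
    linarith
  · rw [smul_eq_mul, mul_one]
    exact hbound _

/-- **A smooth cut-off** (from Mathlib's `ContDiffBump`), as a complex-valued function: `χ = 1` on
`B̄(0, ρₘ)`, `χ = 0` off `B(0, ρ)`, `‖χ‖ ≤ 1`, smooth and compactly supported. -/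
theorem exists_cutoff {ρm ρ : ℝ} (h0 : 0 < ρm) (h1 : ρm < ρ) :
    ∃ χ : ℂ → ℂ, ContDiff ℝ ∞ χ ∧ HasCompactSupport χ ∧
      (∀ z : ℂ, ‖z‖ ≤ ρm → χ z = 1) ∧ (∀ z : ℂ, χ z ≠ 0 → ‖z‖ < ρ) ∧ ∀ z : ℂ, ‖χ z‖ ≤ 1 := by
  obtain ⟨χ₀, hIn, hOut⟩ : ∃ χ₀ : ContDiffBump (0 : ℂ), χ₀.rIn = ρm ∧ χ₀.rOut = ρ :=
    ⟨⟨ρm, ρ, h0, h1⟩, rfl, rfl⟩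
  refine ⟨fun z => ((χ₀ z : ℝ) : ℂ), contDiff_ofReal_comp χ₀.contDiff,
    χ₀.hasCompactSupport.comp_left Complex.ofReal_zero, ?_, ?_, ?_⟩
  · intro z hz
    show ((χ₀ z : ℝ) : ℂ) = 1
    rw [χ₀.one_of_mem_closedBall (by rw [hIn]; exact mem_closedBall_zero_iff.mpr hz),
      Complex.ofReal_one]
  · intro z hz
    by_contra hlt
    apply hz
    show ((χ₀ z : ℝ) : ℂ) = 0
    rw [χ₀.zero_of_le_dist (by rw [hOut, dist_zero_right]; exact le_of_not_gt hlt),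
      Complex.ofReal_zero]
  · intro z
    show ‖((χ₀ z : ℝ) : ℂ)‖ ≤ 1
    rw [Complex.norm_real, Real.norm_of_nonneg χ₀.nonneg]
    exact χ₀.le_one

end ApproxHolomorphic

open ApproxHolomorphic in
/-- **Approximate holomorphy from a small `∂̄`** (Cauchy–Pompeiu with a cut-off). For radii
`0 < ρ' < ρ` there is `C ≥ 0` (namely `C = 4ρ`) such that every smooth `k : ℂ → ℂ` with
`‖∂̄k‖ ≤ ε` on `‖η‖ ≤ ρ` is within `C ε`, uniformly on `‖η‖ ≤ ρ'`, of a function `H` holomorphic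
on `B(0, ρ')`. With a cut-off `χ` (`= 1` on `B̄(0, (ρ' + ρ)/2)`, supported in `B(0, ρ)`):
`χk = T(∂̄χ · k) + T(χ ∂̄k)` by Cauchy–Pompeiu and Leibniz, `H = T(∂̄χ · k)` is holomorphic on
`B(0, ρ')` and `‖T(χ ∂̄k)‖ ≤ 4ρ ε` there. -/
theorem helper_approxHolomorphic (ρ' ρ : ℝ) (hρ' : 0 < ρ') (hρ : ρ' < ρ) :
    ∃ C : ℝ, 0 ≤ C ∧ ∀ (k : ℂ → ℂ) (ε : ℝ), ContDiff ℝ ∞ k → 0 ≤ ε →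
      (∀ η : ℂ, ‖η‖ ≤ ρ → ‖Literature.Analysis.Complex.dbarAlong 1 k η‖ ≤ ε) →
      ∃ H : ℂ → ℂ, DifferentiableOn ℂ H (ball 0 ρ') ∧
        ∀ η : ℂ, ‖η‖ ≤ ρ' → ‖k η - H η‖ ≤ C * ε := by
  have hρ0 : 0 ≤ ρ := by linarith
  obtain ⟨χ, hχ, hχc, hχ1, hχ0, hχle⟩ :=
    exists_cutoff (ρm := (ρ' + ρ) / 2) (ρ := ρ) (by linarith) (by linarith)
  refine ⟨2 * (2 * ρ), by linarith, fun k ε hk hε hdk => ?_⟩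
  -- the two densities `a = ∂̄χ · k` and `e = χ ∂̄k`
  set a : ℂ → ℂ := fun z => dbarAlong 1 χ z * k z with ha_def
  set e : ℂ → ℂ := fun z => χ z * dbarAlong 1 k z with he_def
  have hχ1' : ContDiff ℝ 1 χ := hχ.of_le (by exact_mod_cast le_top)
  have hk1 : ContDiff ℝ 1 k := hk.of_le (by exact_mod_cast le_top)
  have ha_cont : Continuous a := (continuous_dbarAlong_one hχ1').mul hk.continuous
  have he_cont : Continuous e := hχ.continuous.mul (continuous_dbarAlong_one hk1)
  have ha_cpt : HasCompactSupport a := hasCompactSupport_dbarAlong_mul hχc k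
  have he_cpt : HasCompactSupport e := hχc.mul_right (f' := dbarAlong 1 k)
  -- `a` vanishes on the middle ball, where `χ ≡ 1`
  have ha_zero : ∀ z ∈ ball (0 : ℂ) ((ρ' + ρ) / 2), a z = 0 := by
    intro z hz
    have h0 : dbarAlong 1 χ z = 0 := by
      refine dbarAlong_eq_zero_of_eventuallyEq_const (c := 1) ?_
      filter_upwards [isOpen_ball.mem_nhds hz] with w hw
      exact hχ1 w (le_of_lt (mem_ball_zero_iff.mp hw))
    simp [ha_def, h0]
  refine ⟨cauchyTransformAlong 1 a,
    differentiableOn_cauchyTransform_of_eq_zero ha_cont ha_cpt (by linarith) ha_zero,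
    fun η hη => ?_⟩
  -- Cauchy–Pompeiu for `φ = χ k`, Leibniz, linearity, and `χ η = 1`
  have hφ : ContDiff ℝ 1 fun z => χ z * k z := hχ1'.mul hk1
  have hφc : HasCompactSupport fun z => χ z * k z := hχc.mul_right (f' := k)
  have hLeib : dbarAlong 1 (fun z => χ z * k z) = a + e := by
    funext z
    rw [dbarAlong_one_mul ((hχ1'.differentiable one_ne_zero) z)
      ((hk1.differentiable one_ne_zero) z)]
    simp only [ha_def, he_def, Pi.add_apply]
  have hCP : cauchyTransformAlong 1 a η + cauchyTransformAlong 1 e η = k η := by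
    have h := cauchyTransformAlong_dbarAlong_self hφ hφc (one_ne_zero (α := ℂ)) η
    rw [hLeib, cauchyTransformAlong_add ha_cont ha_cpt he_cont he_cpt one_ne_zero] at h
    rw [h]
    show χ η * k η = k η
    rw [hχ1 η (by linarith), one_mul]
  have hdiff : k η - cauchyTransformAlong 1 a η = cauchyTransformAlong 1 e η := by
    rw [← hCP]; ring
  rw [hdiff]
  -- the sup bound on `T e`
  have he_supp : ∀ z, e z ≠ 0 → ‖z‖ < ρ := fun z hz =>
    hχ0 z fun h => hz (by simp [he_def, h])
  have he_bound : ∀ z, ‖e z‖ ≤ ε := by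
    intro z
    by_cases hz : ‖z‖ ≤ ρ
    · calc ‖e z‖ = ‖χ z‖ * ‖dbarAlong 1 k z‖ := by simp only [he_def, norm_mul]
        _ ≤ 1 * ε := mul_le_mul (hχle z) (hdk z hz) (norm_nonneg _) zero_le_one
        _ = ε := one_mul ε
    · have h0 : e z = 0 := by
        by_contra h
        exact hz (le_of_lt (he_supp z h))
      rw [h0, norm_zero]
      exact hε
  exact norm_cauchyTransform_le_of_forall_le hρ0 hε he_supp he_bound (by linarith)

end Summit.SmoothPoincare4.SmoothPoincare4.Cruxes.TameOrBrodyR4.Sketch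

end
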